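import Mathlib.Analysis.Complex.CauchyIntegral
import Mathlib.Analysis.Complex.Trigonometric
import Mathlib.Analysis.SpecialFunctions.Trigonometric.ArctanDeriv
import Mathlib.Analysis.SpecialFunctions.Trigonometric.Complex
import Mathlib.Analysis.SpecialFunctions.Trigonometric.DerivHyp
import Mathlib.MeasureTheory.Integral.IntegralEqImproper
import Mathlib.MeasureTheory.Integral.ExpDecay
import HarnessLib

/-!
# A Cauchy–residue formula on the strip `|Re z| ≤ 1/2` (Rieffel–van Daele, Lemma 4.6)

Rieffel–van Daele, *A bounded operator approach to Tomita–Takesaki theory*, Pacific J. Math. 69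
(1977), Lemma 4.6 (the form of U. Haagerup's argument used to "solve" the operator equation of
Lemma 4.5):

> Let `λ = e^{iφ/2}` where `−π < φ < π`. Let `f` be a complex-valued function defined, bounded and
> continuous on the strip `|Re z| ≤ 1/2` and analytic inside this strip. Then
> `f(0) = ∫ e^{−φt} (e^{πt} + e^{−πt})^{−1} (λ f(it + 1/2) + λ̄ f(it − 1/2)) dt`.

The printed proof applies Cauchy's formula to `g(z) = π e^{iφz} f(z) / sin(πz)`, which has a simple
pole at `0` with residue `f(0)` and tends to zero at infinity in the strip. We follow it with
Mathlib's Cauchy–Goursat theorem for rectangles with a countable exceptional set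
(`Complex.integral_boundary_rect_eq_zero_of_differentiable_on_off_countable`), applied to
`G(z) = π (e^{iφz} f(z) − f(0)) / sin(πz)` — continuous at `0` (value `(e^{iφz} f)'(0)`), so no
residue theorem is needed — on the rectangles `[-1/2, 1/2] × [-N, N]`, letting `N → ∞`; the
normalisation comes from `∫ dt / (e^{πt} + e^{−πt}) = 1/2`.

## Main results

* `integral_inv_exp_pi_add_exp_neg_pi` — `∫ dt/(e^{πt} + e^{−πt}) = 1/2`.
* `RieffelVanDaele_strip_formula` — Lemma 4.6.

## References
* M. A. Rieffel, A. van Daele, *A bounded operator approach to Tomita–Takesaki theory*, Pacific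
  J. Math. 69 (1977) 187–221, Lemma 4.6. [RieffelVandaele1977]
-/

noncomputable section

open Complex MeasureTheory Filter Set intervalIntegral
open scoped Real Topology

namespace Literature.Analysis.Complex

/-! ### Elementary estimates -/

/-- `|sinh (Im z)| ≤ |sin z|`. [folklore] -/
theorem abs_sinh_im_le_norm_sin (z : ℂ) : |Real.sinh z.im| ≤ ‖Complex.sin z‖ := by
  have h : ‖Complex.sin z‖ ^ 2 = Real.sin z.re ^ 2 + Real.sinh z.im ^ 2 := by
    rw [Complex.sin_eq z, ← ofReal_sin, ← ofReal_cosh, ← ofReal_cos, ← ofReal_sinh,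
      ← ofReal_mul, ← ofReal_mul, Complex.sq_norm, Complex.normSq_add_mul_I]
    have hc : Real.cosh z.im ^ 2 = 1 + Real.sinh z.im ^ 2 := by
      nlinarith [Real.cosh_sq z.im]
    nlinarith [Real.sin_sq_add_cos_sq z.re, hc]
  have h2 : Real.sinh z.im ^ 2 ≤ ‖Complex.sin z‖ ^ 2 := by
    rw [h]; nlinarith [sq_nonneg (Real.sin z.re)]
  exact abs_le_of_sq_le_sq' (by simpa using h2) (norm_nonneg _) |>.2 |> fun h' =>
    abs_le.2 ⟨by
      have := abs_le_of_sq_le_sq' (by simpa using h2) (norm_nonneg _)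
      linarith [this.1], by
      have := abs_le_of_sq_le_sq' (by simpa using h2) (norm_nonneg _)
      linarith [this.2]⟩

/-- For `u ≥ 1`, `sinh u ≥ e^u / 4`. [folklore] -/
theorem exp_div_four_le_sinh {u : ℝ} (hu : 1 ≤ u) : Real.exp u / 4 ≤ Real.sinh u := by
  rw [Real.sinh_eq]
  have h1 : Real.exp (-u) ≤ 1 := by rw [Real.exp_le_one_iff]; linarith
  have h2 : (2 : ℝ) ≤ Real.exp u := by
    have := Real.add_one_le_exp u
    linarith
  linarith

/-- `sin (π (1/2 + i t)) = cosh (π t)`. [folklore] -/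
theorem sin_pi_mul_half_add_mul_I (t : ℝ) :
    Complex.sin (π * ((1 / 2 : ℂ) + t * I)) = (Real.cosh (π * t) : ℂ) := by
  rw [show (π : ℂ) * ((1 / 2 : ℂ) + t * I) = (π / 2 : ℂ) + (π * t : ℂ) * I by ring,
    Complex.sin_add_mul_I, Complex.sin_pi_div_two, Complex.cos_pi_div_two]
  simp [Complex.ofReal_cosh]

/-- `sin (π (-1/2 + i t)) = -cosh (π t)`. [folklore] -/
theorem sin_pi_mul_neg_half_add_mul_I (t : ℝ) :
    Complex.sin (π * (-(1 / 2 : ℂ) + t * I)) = -(Real.cosh (π * t) : ℂ) := by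
  rw [show (π : ℂ) * (-(1 / 2 : ℂ) + t * I) = -(π / 2 : ℂ) + (π * t : ℂ) * I by ring,
    Complex.sin_add_mul_I, Complex.sin_neg, Complex.cos_neg, Complex.sin_pi_div_two,
    Complex.cos_pi_div_two]
  simp [Complex.ofReal_cosh]

/-- `2 cosh (π t) = e^{πt} + e^{−πt}`. [folklore] -/
theorem two_mul_cosh_eq (t : ℝ) : 2 * Real.cosh (π * t) = Real.exp (π * t) + Real.exp (-(π * t)) := by
  rw [Real.cosh_eq]; ring

/-- `e^{iφ(±1/2 + it)} = e^{± iφ/2} e^{−φt}`. [folklore] -/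
theorem exp_I_mul_mul (φ : ℝ) (a : ℂ) (t : ℝ) :
    Complex.exp (I * φ * (a + t * I)) = Complex.exp (I * φ * a) * (Real.exp (-(φ * t)) : ℂ) := by
  rw [mul_add, Complex.exp_add, Complex.ofReal_exp]
  congr 1
  congr 1
  rw [show I * (φ : ℂ) * (t * I) = I * I * (φ * t) by ring, I_mul_I]
  push_cast; ring

/-- Integrability of `e^{−b|t|}` on `ℝ` for `b > 0`. [folklore] -/
theorem integrable_exp_neg_mul_abs {b : ℝ} (hb : 0 < b) :
    Integrable fun t : ℝ => Real.exp (-b * |t|) := by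
  have hIoi : IntegrableOn (fun t : ℝ => Real.exp (-b * |t|)) (Ioi 0) := by
    refine (exp_neg_integrableOn_Ioi 0 hb).congr_fun (fun t ht => ?_) measurableSet_Ioi
    rw [abs_of_pos (mem_Ioi.1 ht)]
  have hIic : IntegrableOn (fun t : ℝ => Real.exp (-b * |t|)) (Iic 0) := by
    rw [← Measure.map_neg_eq_self (volume : Measure ℝ)]
    let m : MeasurableEmbedding fun x : ℝ => -x := (Homeomorph.neg ℝ).measurableEmbedding
    rw [m.integrableOn_map_iff]
    simp_rw [Function.comp_def, abs_neg, neg_preimage, neg_Iic, neg_zero]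
    exact Iff.mpr integrableOn_Ici_iff_integrableOn_Ioi hIoi
  have := hIic.union hIoi
  rwa [Iic_union_Ioi, integrableOn_univ] at this

/-- `1/(e^{πt} + e^{−πt}) ≤ e^{−π|t|}`. [folklore] -/
theorem inv_exp_add_exp_le (t : ℝ) :
    1 / (Real.exp (π * t) + Real.exp (-(π * t))) ≤ Real.exp (-π * |t|) := by
  have h1 : 0 < Real.exp (π * t) := Real.exp_pos _
  have h2 : 0 < Real.exp (-(π * t)) := Real.exp_pos _
  rw [div_le_iff₀ (by positivity)]
  rcases le_total 0 t with ht | ht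
  · rw [abs_of_nonneg ht, show -π * t = -(π * t) by ring, mul_add]
    have : Real.exp (-(π * t)) * Real.exp (π * t) = 1 := by
      rw [← Real.exp_add, show -(π * t) + π * t = 0 by ring, Real.exp_zero]
    rw [this]
    linarith [mul_pos h2 h2]
  · rw [abs_of_nonpos ht, show -π * -t = π * t by ring, mul_add]
    have : Real.exp (π * t) * Real.exp (-(π * t)) = 1 := by
      rw [← Real.exp_add, show π * t + -(π * t) = 0 by ring, Real.exp_zero]
    rw [this]
    linarith [mul_pos h1 h1]

/-- The weight `1/(e^{πt} + e^{−πt})` is continuous. [folklore] -/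
theorem continuous_inv_exp_add_exp :
    Continuous fun t : ℝ => 1 / (Real.exp (π * t) + Real.exp (-(π * t))) :=
  continuous_const.div (by fun_prop) fun t => by positivity

/-- The weight `1/(e^{πt} + e^{−πt})` is integrable. [folklore] -/
theorem integrable_inv_exp_add_exp :
    Integrable fun t : ℝ => 1 / (Real.exp (π * t) + Real.exp (-(π * t))) := by
  refine (integrable_exp_neg_mul_abs Real.pi_pos).mono'
    continuous_inv_exp_add_exp.aestronglyMeasurable ?_
  refine Eventually.of_forall fun t => ?_
  rw [Real.norm_eq_abs, abs_of_pos (by positivity)]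
  exact inv_exp_add_exp_le t

/-- **`∫ dt / (e^{πt} + e^{−πt}) = 1/2`** (antiderivative `arctan(e^{πt})/π`). [folklore] -/
theorem integral_inv_exp_pi_add_exp_neg_pi :
    ∫ t : ℝ, 1 / (Real.exp (π * t) + Real.exp (-(π * t))) = 1 / 2 := by
  have hderiv : ∀ t : ℝ, HasDerivAt (fun t => Real.arctan (Real.exp (π * t)) / π)
      (1 / (Real.exp (π * t) + Real.exp (-(π * t)))) t := by
    intro t
    have h1 : HasDerivAt (fun t => Real.exp (π * t)) (Real.exp (π * t) * (π * 1)) t :=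
      ((hasDerivAt_id t).const_mul π).exp
    have h2 := h1.arctan
    have h3 := h2.div_const π
    have hE : Real.exp (π * t) ≠ 0 := (Real.exp_pos _).ne'
    have heq : 1 / (1 + Real.exp (π * t) ^ 2) * (Real.exp (π * t) * (π * 1)) / π =
        1 / (Real.exp (π * t) + Real.exp (-(π * t))) := by
      rw [Real.exp_neg]
      field_simp
      ring
    rw [heq] at h3
    exact h3
  have htop : Tendsto (fun t : ℝ => Real.arctan (Real.exp (π * t)) / π) atTop (𝓝 (π / 2 / π)) := by
    refine Tendsto.div_const ?_ π
    have h1 : Tendsto (fun t : ℝ => Real.exp (π * t)) atTop atTop :=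
      Real.tendsto_exp_atTop.comp (tendsto_id.const_mul_atTop Real.pi_pos)
    exact (tendsto_nhds_of_tendsto_nhdsWithin Real.tendsto_arctan_atTop).comp h1
  have hbot : Tendsto (fun t : ℝ => Real.arctan (Real.exp (π * t)) / π) atBot (𝓝 (0 / π)) := by
    refine Tendsto.div_const ?_ π
    have h1 : Tendsto (fun t : ℝ => Real.exp (π * t)) atBot (𝓝 0) :=
      Real.tendsto_exp_atBot.comp (tendsto_id.const_mul_atBot Real.pi_pos)
    have := (Real.continuous_arctan.tendsto 0).comp h1
    rw [Real.arctan_zero] at this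
    exact this
  rw [integral_of_hasDerivAt_of_tendsto hderiv integrable_inv_exp_add_exp hbot htop]
  field_simp
  ring

/-! ### The auxiliary function `G` -/

section Aux

variable {f : ℂ → ℂ} {φ : ℝ}

/-- The closed strip `|Re z| ≤ 1/2`. [cite: RieffelVandaele1977, Lemma 4.6] -/
def closedStrip : Set ℂ := {z : ℂ | |z.re| ≤ 1 / 2}

/-- The open strip `|Re z| < 1/2`. [cite: RieffelVandaele1977, Lemma 4.6] -/
def openStrip : Set ℂ := {z : ℂ | |z.re| < 1 / 2}

/-- The open strip is open. [folklore] -/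
theorem isOpen_openStrip : IsOpen openStrip :=
  isOpen_lt (continuous_abs.comp Complex.continuous_re) continuous_const

/-- The open strip is contained in the closed strip. [folklore] -/
theorem openStrip_subset_closedStrip : openStrip ⊆ closedStrip := fun z hz => by
  simp only [openStrip, closedStrip, mem_setOf_eq] at hz ⊢
  exact hz.le

/-- `0` lies in the open strip. [folklore] -/
theorem zero_mem_openStrip : (0 : ℂ) ∈ openStrip := by
  simp [openStrip]

/-- In the closed strip, `sin (π z)` vanishes only at `z = 0`. [folklore] -/
theorem sin_pi_mul_ne_zero {z : ℂ} (hz : z ∈ closedStrip) (h0 : z ≠ 0) : Complex.sin (π * z) ≠ 0 := by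
  intro h
  obtain ⟨k, hk⟩ := Complex.sin_eq_zero_iff.1 h
  have hzk : z = k := by
    have hπ : (π : ℂ) ≠ 0 := ofReal_ne_zero.2 Real.pi_ne_zero
    have : (π : ℂ) * z = π * k := by rw [hk]; ring
    exact mul_left_cancel₀ hπ this
  have hre : |(k : ℝ)| ≤ 1 / 2 := by
    have := hz
    simp only [closedStrip, mem_setOf_eq, hzk] at this
    simpa using this
  have hk0 : k = 0 := by
    have h1 : |(k : ℝ)| < 1 := lt_of_le_of_lt hre (by norm_num)
    have : |k| < 1 := by exact_mod_cast h1
    exact Int.abs_lt_one_iff.1 this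
  exact h0 (by rw [hzk, hk0]; simp)

variable (f φ)

/-- The auxiliary function `G(z) = π (e^{iφz} f(z) − f(0)) / sin(πz)`, extended to `z = 0` by the
derivative of `e^{iφz} f(z)` at `0`. [cite: RieffelVandaele1977, Lemma 4.6 (proof)] -/
def auxG (z : ℂ) : ℂ :=
  if z = 0 then deriv (fun w => Complex.exp (I * φ * w) * f w) 0
  else π * (Complex.exp (I * φ * z) * f z - f 0) / Complex.sin (π * z)

/-- The formula for `G` away from `0`. [cite: RieffelVandaele1977, Lemma 4.6 (proof)] -/
theorem auxG_of_ne_zero {z : ℂ} (hz : z ≠ 0) :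
    auxG f φ z = π * (Complex.exp (I * φ * z) * f z - f 0) / Complex.sin (π * z) := by
  simp [auxG, hz]

variable {f φ}

/-- `G` is continuous at the nonzero points of the closed strip (within the strip). [folklore] -/
theorem continuousWithinAt_auxG_of_ne_zero (hcont : ContinuousOn f closedStrip) {z : ℂ}
    (hz : z ∈ closedStrip) (h0 : z ≠ 0) : ContinuousWithinAt (auxG f φ) closedStrip z := by
  have heq : auxG f φ =ᶠ[𝓝[closedStrip] z]
      fun w => π * (Complex.exp (I * φ * w) * f w - f 0) / Complex.sin (π * w) := by
    have : ∀ᶠ w in 𝓝[closedStrip] z, w ≠ 0 :=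
      mem_nhdsWithin_of_mem_nhds (isOpen_ne.mem_nhds h0)
    filter_upwards [this] with w hw
    exact auxG_of_ne_zero f φ hw
  refine ContinuousWithinAt.congr_of_eventuallyEq ?_ heq (auxG_of_ne_zero f φ h0)
  refine ContinuousWithinAt.div ?_ ?_ (sin_pi_mul_ne_zero hz h0)
  · have hexp : Continuous fun w : ℂ => Complex.exp (I * φ * w) :=
      Complex.continuous_exp.comp (continuous_const.mul continuous_id)
    have h1 : ContinuousWithinAt (fun w => Complex.exp (I * φ * w) * f w) closedStrip z :=
      hexp.continuousWithinAt.mul (hcont z hz)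
    exact continuousWithinAt_const.mul (h1.sub continuousWithinAt_const)
  · exact (Complex.continuous_sin.comp (continuous_const.mul continuous_id)).continuousWithinAt

/-- `G` is continuous at `0`: `G(z) → (e^{iφz} f)'(0)`. [folklore] -/
theorem continuousAt_auxG_zero (hdiff : DifferentiableOn ℂ f openStrip) :
    ContinuousAt (auxG f φ) 0 := by
  -- `h(z) = e^{iφz} f(z)` is differentiable at `0`
  set h : ℂ → ℂ := fun w => Complex.exp (I * φ * w) * f w with hh
  have hf0 : DifferentiableAt ℂ f 0 :=
    hdiff.differentiableAt (isOpen_openStrip.mem_nhds zero_mem_openStrip)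
  have hhd : HasDerivAt h (deriv h 0) 0 := by
    have : DifferentiableAt ℂ h 0 := by
      apply DifferentiableAt.mul _ hf0
      exact (Complex.differentiable_exp.comp (by fun_prop)).differentiableAt
    exact this.hasDerivAt
  -- slope of `h` at `0`
  have hslope : Tendsto (fun z => z⁻¹ * (h z - h 0)) (𝓝[≠] 0) (𝓝 (deriv h 0)) := by
    have := hhd.tendsto_slope_zero
    simpa using this
  -- `sin (π z) / z → π`
  have hsin : Tendsto (fun z : ℂ => z⁻¹ * Complex.sin (π * z)) (𝓝[≠] 0) (𝓝 π) := by
    have hd : HasDerivAt (fun z : ℂ => Complex.sin (π * z)) π 0 := by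
      have := ((hasDerivAt_id (0 : ℂ)).const_mul (π : ℂ)).csin
      simpa using this
    have := hd.tendsto_slope_zero
    simpa using this
  -- combine: `G z = (slope h) * π / (sin(πz)/z)` near `0`
  have hlim : Tendsto (fun z => (z⁻¹ * (h z - h 0)) * (π / (z⁻¹ * Complex.sin (π * z)))) (𝓝[≠] 0)
      (𝓝 (deriv h 0 * (π / π))) :=
    hslope.mul (tendsto_const_nhds.div hsin (ofReal_ne_zero.2 Real.pi_ne_zero))
  rw [div_self (ofReal_ne_zero.2 Real.pi_ne_zero), mul_one] at hlim
  have heq : (fun z => (z⁻¹ * (h z - h 0)) * (π / (z⁻¹ * Complex.sin (π * z)))) =ᶠ[𝓝[≠] 0]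
      auxG f φ := by
    -- near `0` (and `≠ 0`), `sin (π z) ≠ 0`
    have h1 : ∀ᶠ z in 𝓝[≠] (0 : ℂ), z ∈ openStrip :=
      mem_nhdsWithin_of_mem_nhds (isOpen_openStrip.mem_nhds zero_mem_openStrip)
    have h2 : ∀ᶠ z in 𝓝[≠] (0 : ℂ), z ≠ 0 := self_mem_nhdsWithin
    filter_upwards [h1, h2] with z hz hz0
    have hs : Complex.sin (π * z) ≠ 0 := sin_pi_mul_ne_zero (openStrip_subset_closedStrip hz) hz0
    rw [auxG_of_ne_zero f φ hz0]
    have h0 : h 0 = f 0 := by simp [hh]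
    have hz' : h z = Complex.exp (I * φ * z) * f z := rfl
    rw [h0, hz']
    field_simp
  have hlim' := hlim.congr' heq
  -- continuity at `0`: value `deriv h 0`
  have : ContinuousWithinAt (auxG f φ) {0}ᶜ 0 := by
    rw [ContinuousWithinAt, show auxG f φ 0 = deriv h 0 by simp [auxG, hh]]
    exact hlim'
  exact continuousWithinAt_compl_self.1 this

end Aux

/-! ### Differentiability, bounds -/

section Bounds

variable {f : ℂ → ℂ} {φ : ℝ}

/-- `G` is complex differentiable at the nonzero points of the open strip. [folklore] -/
theorem differentiableAt_auxG (hdiff : DifferentiableOn ℂ f openStrip) {z : ℂ} (hz : z ∈ openStrip)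
    (h0 : z ≠ 0) : DifferentiableAt ℂ (auxG f φ) z := by
  have heq : auxG f φ =ᶠ[𝓝 z]
      fun w => π * (Complex.exp (I * φ * w) * f w - f 0) / Complex.sin (π * w) := by
    filter_upwards [isOpen_ne.mem_nhds h0] with w hw
    exact auxG_of_ne_zero f φ hw
  refine DifferentiableAt.congr_of_eventuallyEq ?_ heq
  have hf : DifferentiableAt ℂ f z := hdiff.differentiableAt (isOpen_openStrip.mem_nhds hz)
  refine DifferentiableAt.div ?_ ?_ (sin_pi_mul_ne_zero (openStrip_subset_closedStrip hz) h0)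
  · refine (differentiableAt_const _).mul ((DifferentiableAt.mul ?_ hf).sub (differentiableAt_const _))
    exact (differentiableAt_id.const_mul _).cexp
  · exact (differentiableAt_id.const_mul _).csin

/-- `G` is continuous on the closed strip. [folklore] -/
theorem continuousOn_auxG (hcont : ContinuousOn f closedStrip)
    (hdiff : DifferentiableOn ℂ f openStrip) : ContinuousOn (auxG f φ) closedStrip := by
  intro z hz
  by_cases h0 : z = 0
  · subst h0
    exact (continuousAt_auxG_zero hdiff).continuousWithinAt
  · exact continuousWithinAt_auxG_of_ne_zero hcont hz h0

/-- `‖e^{iφz}‖ ≤ e^{|φ| |Im z|}`. [folklore] -/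
theorem norm_exp_I_mul_le (φ : ℝ) (z : ℂ) :
    ‖Complex.exp (I * φ * z)‖ ≤ Real.exp (|φ| * |z.im|) := by
  rw [Complex.norm_exp]
  apply Real.exp_le_exp.2
  have : (I * φ * z).re = -(φ * z.im) := by simp [mul_assoc]
  rw [this, ← abs_mul]
  exact neg_le_abs _

/-- `0 ≤ C` follows from the bound at `0`. [folklore] -/
theorem nonneg_of_bound {C : ℝ} (hbdd : ∀ z ∈ closedStrip, ‖f z‖ ≤ C) : 0 ≤ C :=
  le_trans (norm_nonneg _) (hbdd 0 (by simp [closedStrip]))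

/-- **Pointwise bound**: for `z ≠ 0` in the closed strip,
`‖G z‖ ≤ π (e^{|φ||Im z|} + 1) C / ‖sin (π z)‖`. [folklore] -/
theorem norm_auxG_le {C : ℝ} (hbdd : ∀ z ∈ closedStrip, ‖f z‖ ≤ C) {z : ℂ} (hz : z ∈ closedStrip)
    (h0 : z ≠ 0) :
    ‖auxG f φ z‖ ≤ π * ((Real.exp (|φ| * |z.im|) + 1) * C) / ‖Complex.sin (π * z)‖ := by
  have hC : 0 ≤ C := nonneg_of_bound hbdd
  have hs : Complex.sin (π * z) ≠ 0 := sin_pi_mul_ne_zero hz h0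
  rw [auxG_of_ne_zero f φ h0, norm_div, norm_mul, Complex.norm_real, Real.norm_eq_abs,
    abs_of_pos Real.pi_pos]
  gcongr
  calc ‖Complex.exp (I * φ * z) * f z - f 0‖
      ≤ ‖Complex.exp (I * φ * z) * f z‖ + ‖f 0‖ := norm_sub_le _ _
    _ = ‖Complex.exp (I * φ * z)‖ * ‖f z‖ + ‖f 0‖ := by rw [norm_mul]
    _ ≤ Real.exp (|φ| * |z.im|) * C + C := by
        gcongr
        · exact norm_exp_I_mul_le φ z
        · exact hbdd z hz
        · exact hbdd 0 (by simp [closedStrip])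
    _ = (Real.exp (|φ| * |z.im|) + 1) * C := by ring

/-- From a lower bound `e^{π|y|}/a ≤ ‖sin (π z)‖` to the exponential bound on `G`. [folklore] -/
theorem norm_auxG_le_exp {C a : ℝ} (ha : 0 < a) (hbdd : ∀ z ∈ closedStrip, ‖f z‖ ≤ C) {z : ℂ}
    (hz : z ∈ closedStrip) (h0 : z ≠ 0)
    (hsin : Real.exp (π * |z.im|) / a ≤ ‖Complex.sin (π * z)‖) :
    ‖auxG f φ z‖ ≤ 2 * a * π * C * Real.exp ((|φ| - π) * |z.im|) := by
  have hC : 0 ≤ C := nonneg_of_bound hbdd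
  have hspos : 0 < Real.exp (π * |z.im|) / a := by positivity
  refine (norm_auxG_le hbdd hz h0).trans ?_
  rw [div_le_iff₀ (lt_of_lt_of_le hspos hsin)]
  have h1 : Real.exp (|φ| * |z.im|) + 1 ≤ 2 * Real.exp (|φ| * |z.im|) := by
    have : 1 ≤ Real.exp (|φ| * |z.im|) := Real.one_le_exp (by positivity)
    linarith
  calc π * ((Real.exp (|φ| * |z.im|) + 1) * C)
      ≤ π * ((2 * Real.exp (|φ| * |z.im|)) * C) := by gcongr
    _ = 2 * a * π * C * Real.exp ((|φ| - π) * |z.im|) * (Real.exp (π * |z.im|) / a) := by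
        rw [show (|φ| - π) * |z.im| = |φ| * |z.im| - π * |z.im| by ring, Real.exp_sub]
        field_simp
    _ ≤ 2 * a * π * C * Real.exp ((|φ| - π) * |z.im|) * ‖Complex.sin (π * z)‖ := by
        gcongr

/-- **Bound on horizontal segments**: for `|x| ≤ 1/2`, `|y| ≥ 1`,
`‖G (x + iy)‖ ≤ 8 π C e^{(|φ| − π)|y|}`. [folklore] -/
theorem norm_auxG_horizontal_le {C : ℝ} (hbdd : ∀ z ∈ closedStrip, ‖f z‖ ≤ C) {x y : ℝ}
    (hx : |x| ≤ 1 / 2) (hy : 1 ≤ |y|) :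
    ‖auxG f φ (x + y * I)‖ ≤ 8 * π * C * Real.exp ((|φ| - π) * |y|) := by
  have hz : (x + y * I : ℂ) ∈ closedStrip := by simpa [closedStrip] using hx
  have hy0 : y ≠ 0 := by intro h; rw [h, abs_zero] at hy; linarith
  have h0 : (x + y * I : ℂ) ≠ 0 := by
    intro h; apply hy0; simpa using congrArg Complex.im h
  have him : (x + y * I : ℂ).im = y := by simp
  have hsin : Real.exp (π * |y|) / 4 ≤ ‖Complex.sin (π * (x + y * I))‖ := by
    have h1 := abs_sinh_im_le_norm_sin (π * (x + y * I))
    have him' : (π * (x + y * I) : ℂ).im = π * y := by simp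
    rw [him'] at h1
    refine le_trans ?_ h1
    have h2 : |Real.sinh (π * y)| = Real.sinh (π * |y|) := by
      rcases le_total 0 y with h | h
      · rw [abs_of_nonneg h, abs_of_nonneg (Real.sinh_nonneg_iff.2 (by positivity))]
      · rw [abs_of_nonpos h, show π * -y = -(π * y) by ring, Real.sinh_neg,
          abs_of_nonpos (Real.sinh_nonpos_iff.2 (by nlinarith [Real.pi_pos]))]
    rw [h2]
    exact exp_div_four_le_sinh (by nlinarith [Real.two_le_pi])
  have := norm_auxG_le_exp (φ := φ) (by norm_num : (0 : ℝ) < 4) hbdd hz h0 (by rw [him]; exact hsin)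
  rw [him] at this
  calc ‖auxG f φ (x + y * I)‖ ≤ 2 * 4 * π * C * Real.exp ((|φ| - π) * |y|) := this
    _ = 8 * π * C * Real.exp ((|φ| - π) * |y|) := by ring

/-- `e^{|u|}/2 ≤ cosh u`. [folklore] -/
theorem exp_abs_div_two_le_cosh (u : ℝ) : Real.exp |u| / 2 ≤ Real.cosh u := by
  rw [Real.cosh_eq]
  rcases le_total 0 u with h | h
  · rw [abs_of_nonneg h]; linarith [Real.exp_pos (-u)]
  · rw [abs_of_nonpos h]; linarith [Real.exp_pos u]

/-- **Bound on the vertical lines** `Re z = ±1/2`: `‖G(±1/2 + it)‖ ≤ 4 π C e^{(|φ| − π)|t|}`. [folklore] -/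
theorem norm_auxG_vertical_le {C : ℝ} (hbdd : ∀ z ∈ closedStrip, ‖f z‖ ≤ C) {a : ℝ}
    (ha : a = 1 / 2 ∨ a = -(1 / 2)) (t : ℝ) :
    ‖auxG f φ (a + t * I)‖ ≤ 4 * π * C * Real.exp ((|φ| - π) * |t|) := by
  have hz : (a + t * I : ℂ) ∈ closedStrip := by
    rcases ha with h | h <;> simp [closedStrip, h]
  have h0 : (a + t * I : ℂ) ≠ 0 := by
    intro h
    have := congrArg Complex.re h
    simp at this
    rcases ha with h' | h' <;> rw [h'] at this <;> norm_num at this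
  have him : (a + t * I : ℂ).im = t := by simp
  have hsin : Real.exp (π * |t|) / 2 ≤ ‖Complex.sin (π * (a + t * I))‖ := by
    have hcosh : ‖Complex.sin (π * (a + t * I))‖ = Real.cosh (π * t) := by
      rcases ha with h | h
      · rw [h, show ((1 / 2 : ℝ) : ℂ) = (1 / 2 : ℂ) by push_cast; ring, sin_pi_mul_half_add_mul_I,
          Complex.norm_real, Real.norm_eq_abs, abs_of_pos (Real.cosh_pos _)]
      · rw [h, show ((-(1 / 2) : ℝ) : ℂ) = -(1 / 2 : ℂ) by push_cast; ring,
          sin_pi_mul_neg_half_add_mul_I, norm_neg, Complex.norm_real, Real.norm_eq_abs,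
          abs_of_pos (Real.cosh_pos _)]
    rw [hcosh]
    have := exp_abs_div_two_le_cosh (π * t)
    rwa [abs_mul, abs_of_pos Real.pi_pos] at this
  have := norm_auxG_le_exp (φ := φ) (by norm_num : (0 : ℝ) < 2) hbdd hz h0 (by rw [him]; exact hsin)
  rw [him] at this
  calc ‖auxG f φ (a + t * I)‖ ≤ 2 * 2 * π * C * Real.exp ((|φ| - π) * |t|) := this
    _ = 4 * π * C * Real.exp ((|φ| - π) * |t|) := by ring

end Bounds

/-! ### The main formula -/

section Main

variable {f : ℂ → ℂ} {φ : ℝ}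

/-- The points `a + it` of the vertical lines `a = ±1/2` lie in the closed strip. [folklore] -/
theorem line_mem_closedStrip {a : ℝ} (ha : a = 1 / 2 ∨ a = -(1 / 2)) (t : ℝ) :
    ((a : ℂ) + t * I) ∈ closedStrip := by
  rcases ha with h | h <;> simp [closedStrip, h]

/-- `t ↦ G(a + it)` is continuous for `a = ±1/2`. [folklore] -/
theorem continuous_auxG_vertical (hcont : ContinuousOn f closedStrip)
    (hdiff : DifferentiableOn ℂ f openStrip) {a : ℝ} (ha : a = 1 / 2 ∨ a = -(1 / 2)) :
    Continuous fun t : ℝ => auxG f φ ((a : ℂ) + t * I) :=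
  (continuousOn_auxG hcont hdiff).comp_continuous (by fun_prop) (line_mem_closedStrip ha)

/-- `t ↦ G(a + it)` is integrable for `a = ±1/2` (exponential decay, `|φ| < π`). [folklore] -/
theorem integrable_auxG_vertical (hφ : |φ| < π) (hcont : ContinuousOn f closedStrip)
    (hdiff : DifferentiableOn ℂ f openStrip) {C : ℝ} (hbdd : ∀ z ∈ closedStrip, ‖f z‖ ≤ C)
    {a : ℝ} (ha : a = 1 / 2 ∨ a = -(1 / 2)) :
    Integrable fun t : ℝ => auxG f φ ((a : ℂ) + t * I) := by
  refine Integrable.mono' ((integrable_exp_neg_mul_abs (sub_pos.2 hφ)).const_mul (4 * π * C))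
    (continuous_auxG_vertical hcont hdiff ha).aestronglyMeasurable (Eventually.of_forall fun t => ?_)
  have h := norm_auxG_vertical_le (φ := φ) hbdd ha t
  rwa [show (|φ| - π) * |t| = -(π - |φ|) * |t| by ring] at h

/-- `t ↦ f(a + it)` is continuous for `a = ±1/2`. [folklore] -/
theorem continuous_f_vertical (hcont : ContinuousOn f closedStrip) {a : ℝ}
    (ha : a = 1 / 2 ∨ a = -(1 / 2)) : Continuous fun t : ℝ => f ((a : ℂ) + t * I) :=
  hcont.comp_continuous (by fun_prop) (line_mem_closedStrip ha)

/-- **The rectangle identity** (Cauchy–Goursat on `[-1/2, 1/2] × [-N, N]` for `G`, exceptional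
set `{0}`). [cite: RieffelVandaele1977, Lemma 4.6 (proof)] -/
theorem auxG_rect_eq_zero (hcont : ContinuousOn f closedStrip) (hdiff : DifferentiableOn ℂ f openStrip)
    (N : ℝ) :
    (∫ x : ℝ in (-(1 / 2) : ℝ)..(1 / 2), auxG f φ (x + (-N : ℝ) * I)) -
      (∫ x : ℝ in (-(1 / 2) : ℝ)..(1 / 2), auxG f φ (x + (N : ℝ) * I)) +
      I • (∫ y : ℝ in (-N : ℝ)..N, auxG f φ (((1 / 2 : ℝ) : ℂ) + y * I)) -
      I • (∫ y : ℝ in (-N : ℝ)..N, auxG f φ (((-(1 / 2) : ℝ) : ℂ) + y * I)) = 0 := by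
  have h := Complex.integral_boundary_rect_eq_zero_of_differentiable_on_off_countable (auxG f φ)
    (⟨-(1 / 2), -N⟩ : ℂ) ⟨1 / 2, N⟩ {0} (Set.countable_singleton 0) ?_ ?_
  · simpa using h
  · refine (continuousOn_auxG hcont hdiff).mono fun z hz => ?_
    rw [Complex.mem_reProdIm] at hz
    have hre := hz.1
    simp only [closedStrip, mem_setOf_eq]
    rw [Set.mem_uIcc] at hre
    rcases hre with ⟨h1, h2⟩ | ⟨h1, h2⟩ <;> · rw [abs_le]; constructor <;> linarith
  · intro z hz
    rw [Set.mem_sdiff, Complex.mem_reProdIm, Set.mem_singleton_iff] at hz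
    obtain ⟨⟨hre, -⟩, h0⟩ := hz
    refine differentiableAt_auxG hdiff ?_ h0
    simp only [openStrip, mem_setOf_eq, abs_lt]
    have : min (-(1 / 2) : ℝ) (1 / 2) = -(1 / 2) := by norm_num
    have : max (-(1 / 2) : ℝ) (1 / 2) = 1 / 2 := by norm_num
    simp only [Set.mem_Ioo] at hre
    constructor <;> [skip; skip] <;> simp_all

/-- The horizontal integrals tend to zero. [cite: RieffelVandaele1977, Lemma 4.6 (proof)] -/
theorem tendsto_auxG_horizontal (hφ : |φ| < π) {C : ℝ} (hbdd : ∀ z ∈ closedStrip, ‖f z‖ ≤ C)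
    (s : ℝ) (hs : s = 1 ∨ s = -1) :
    Tendsto (fun N : ℝ => ∫ x : ℝ in (-(1 / 2) : ℝ)..(1 / 2), auxG f φ (x + (s * N : ℝ) * I))
      atTop (𝓝 0) := by
  have hC : 0 ≤ C := nonneg_of_bound hbdd
  have hbound : ∀ᶠ N : ℝ in atTop, ‖∫ x : ℝ in (-(1 / 2) : ℝ)..(1 / 2), auxG f φ (x + (s * N : ℝ) * I)‖
      ≤ 8 * π * C * Real.exp ((|φ| - π) * N) := by
    filter_upwards [eventually_ge_atTop (1 : ℝ)] with N hN
    have habs : |s * N| = N := by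
      rcases hs with h | h <;> simp [h, abs_of_pos (lt_of_lt_of_le zero_lt_one hN)]
    have := intervalIntegral.norm_integral_le_of_norm_le_const (a := (-(1 / 2) : ℝ)) (b := 1 / 2)
      (C := 8 * π * C * Real.exp ((|φ| - π) * N)) (f := fun x : ℝ => auxG f φ (x + (s * N : ℝ) * I))
      (fun x hx => by
        have hx' : |x| ≤ 1 / 2 := by
          rw [Set.uIoc_of_le (by norm_num)] at hx
          rw [abs_le]; exact ⟨by linarith [hx.1], hx.2⟩
        have h := norm_auxG_horizontal_le (φ := φ) hbdd hx' (y := s * N) (by rw [habs]; exact hN)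
        rwa [habs] at h)
    rw [show |(1 / 2 : ℝ) - -(1 / 2)| = 1 by norm_num, mul_one] at this
    simpa using this
  refine squeeze_zero_norm' hbound ?_
  have hexp : Tendsto (fun N : ℝ => Real.exp ((|φ| - π) * N)) atTop (𝓝 0) :=
    Real.tendsto_exp_atBot.comp ((tendsto_id.const_mul_atTop_of_neg (by linarith)))
  simpa using hexp.const_mul (8 * π * C)

/-- **Equality of the two vertical integrals**: `∫ G(1/2 + it) dt = ∫ G(−1/2 + it) dt`.
[cite: RieffelVandaele1977, Lemma 4.6 (proof)] -/
theorem integral_auxG_vertical_eq (hφ : |φ| < π) (hcont : ContinuousOn f closedStrip)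
    (hdiff : DifferentiableOn ℂ f openStrip) {C : ℝ} (hbdd : ∀ z ∈ closedStrip, ‖f z‖ ≤ C) :
    ∫ t : ℝ, auxG f φ (((1 / 2 : ℝ) : ℂ) + t * I) = ∫ t : ℝ, auxG f φ (((-(1 / 2) : ℝ) : ℂ) + t * I) := by
  set R := ∫ t : ℝ, auxG f φ (((1 / 2 : ℝ) : ℂ) + t * I) with hR
  set L := ∫ t : ℝ, auxG f φ (((-(1 / 2) : ℝ) : ℂ) + t * I) with hL
  -- the combination in the rectangle identity tends to `0 - 0 + I R - I L`
  have h1 := tendsto_auxG_horizontal (φ := φ) hφ hbdd (-1) (Or.inr rfl)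
  have h2 := tendsto_auxG_horizontal (φ := φ) hφ hbdd 1 (Or.inl rfl)
  have h3 : Tendsto (fun N : ℝ => ∫ y : ℝ in (-N : ℝ)..N, auxG f φ (((1 / 2 : ℝ) : ℂ) + y * I))
      atTop (𝓝 R) :=
    intervalIntegral_tendsto_integral (integrable_auxG_vertical hφ hcont hdiff hbdd (Or.inl rfl))
      tendsto_neg_atTop_atBot tendsto_id
  have h4 : Tendsto (fun N : ℝ => ∫ y : ℝ in (-N : ℝ)..N, auxG f φ (((-(1 / 2) : ℝ) : ℂ) + y * I))
      atTop (𝓝 L) :=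
    intervalIntegral_tendsto_integral (integrable_auxG_vertical hφ hcont hdiff hbdd (Or.inr rfl))
      tendsto_neg_atTop_atBot tendsto_id
  have hlim := ((h1.sub h2).add (h3.const_smul I)).sub (h4.const_smul I)
  have hzero : ∀ᶠ N : ℝ in atTop,
      ((∫ x : ℝ in (-(1 / 2) : ℝ)..(1 / 2), auxG f φ (x + ((-1) * N : ℝ) * I)) -
        (∫ x : ℝ in (-(1 / 2) : ℝ)..(1 / 2), auxG f φ (x + ((1 : ℝ) * N : ℝ) * I)) +
        I • (∫ y : ℝ in (-N : ℝ)..N, auxG f φ (((1 / 2 : ℝ) : ℂ) + y * I)) -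
        I • (∫ y : ℝ in (-N : ℝ)..N, auxG f φ (((-(1 / 2) : ℝ) : ℂ) + y * I))) = 0 := by
    filter_upwards [eventually_gt_atTop (0 : ℝ)] with N hN
    have := auxG_rect_eq_zero (φ := φ) hcont hdiff N
    simpa using this
  have hlim0 := tendsto_nhds_unique hlim (tendsto_const_nhds.congr' (hzero.mono fun N hN => hN.symm))
  -- `0 - 0 + I R - I L = 0`
  have : I • R - I • L = 0 := by simpa using hlim0
  rw [← smul_sub, smul_eq_zero] at this
  rcases this with h | h
  · exact absurd h I_ne_zero
  · exact sub_eq_zero.1 h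

/-- The weight `w(t) = e^{−φt}/(e^{πt} + e^{−πt})` of Lemma 4.6. [cite: RieffelVandaele1977, Lemma 4.6] -/
def weight (φ t : ℝ) : ℝ := Real.exp (-(φ * t)) / (Real.exp (π * t) + Real.exp (-(π * t)))

/-- `|w(t)| ≤ e^{−(π − |φ|)|t|}`. [folklore] -/
theorem abs_weight_le (φ t : ℝ) : |weight φ t| ≤ Real.exp (-(π - |φ|) * |t|) := by
  rw [weight, abs_of_nonneg (by positivity), div_eq_mul_one_div]
  calc Real.exp (-(φ * t)) * (1 / (Real.exp (π * t) + Real.exp (-(π * t))))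
      ≤ Real.exp (|φ| * |t|) * Real.exp (-π * |t|) := by
        gcongr
        · rw [← abs_mul]; exact neg_le_abs _
        · exact inv_exp_add_exp_le t
    _ = Real.exp (-(π - |φ|) * |t|) := by rw [← Real.exp_add]; ring_nf

/-- `G(1/2 + it)` in terms of the weight. [cite: RieffelVandaele1977, Lemma 4.6 (proof)] -/
theorem auxG_half (t : ℝ) :
    auxG f φ (((1 / 2 : ℝ) : ℂ) + t * I) =
      (2 * π * weight φ t : ℝ) * (Complex.exp (I * (φ / 2)) * f ((1 / 2 : ℂ) + t * I)) -
        (2 * π * (1 / (Real.exp (π * t) + Real.exp (-(π * t)))) : ℝ) * f 0 := by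
  have hhalf : (((1 / 2 : ℝ) : ℂ)) = (1 / 2 : ℂ) := by push_cast; ring
  have h0 : ((1 / 2 : ℂ) + t * I) ≠ 0 := by
    intro h; have := congrArg Complex.re h; simp at this
  rw [hhalf, auxG_of_ne_zero f φ h0, sin_pi_mul_half_add_mul_I, exp_I_mul_mul]
  have hcosh : (Real.cosh (π * t) : ℂ) = ((Real.exp (π * t) + Real.exp (-(π * t))) / 2 : ℝ) := by
    rw [Real.cosh_eq]
  have hne : (Real.exp (π * t) + Real.exp (-(π * t)) : ℂ) ≠ 0 := by
    norm_cast; positivity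
  rw [hcosh, weight]
  have : I * (φ : ℂ) * (1 / 2) = I * (φ / 2) := by ring
  rw [this]
  push_cast
  field_simp

/-- `G(-1/2 + it)` in terms of the weight. [cite: RieffelVandaele1977, Lemma 4.6 (proof)] -/
theorem auxG_neg_half (t : ℝ) :
    auxG f φ (((-(1 / 2) : ℝ) : ℂ) + t * I) =
      -((2 * π * weight φ t : ℝ) * (Complex.exp (-(I * (φ / 2))) * f (-(1 / 2 : ℂ) + t * I))) +
        (2 * π * (1 / (Real.exp (π * t) + Real.exp (-(π * t)))) : ℝ) * f 0 := by
  have hhalf : (((-(1 / 2) : ℝ) : ℂ)) = -(1 / 2 : ℂ) := by push_cast; ring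
  have h0 : (-(1 / 2 : ℂ) + t * I) ≠ 0 := by
    intro h; have := congrArg Complex.re h; simp at this
  rw [hhalf, auxG_of_ne_zero f φ h0, sin_pi_mul_neg_half_add_mul_I, exp_I_mul_mul]
  have hcosh : (Real.cosh (π * t) : ℂ) = ((Real.exp (π * t) + Real.exp (-(π * t))) / 2 : ℝ) := by
    rw [Real.cosh_eq]
  have hne : (Real.exp (π * t) + Real.exp (-(π * t)) : ℂ) ≠ 0 := by
    norm_cast; positivity
  rw [hcosh, weight]
  have : I * (φ : ℂ) * (-(1 / 2)) = -(I * (φ / 2)) := by ring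
  rw [this]
  push_cast
  field_simp
  ring

/-- **Rieffel–van Daele, Lemma 4.6.** Let `|φ| < π` and let `f` be bounded and continuous on the
strip `|Re z| ≤ 1/2` and analytic inside. Then, with `λ = e^{iφ/2}`,
`f(0) = ∫ e^{−φt} (e^{πt} + e^{−πt})^{−1} (λ f(1/2 + it) + λ̄ f(−1/2 + it)) dt`.
[cite: RieffelVandaele1977, Lemma 4.6] -/
theorem RieffelVanDaele_strip_formula (hφ : |φ| < π) (hcont : ContinuousOn f closedStrip)
    (hdiff : DifferentiableOn ℂ f openStrip) {C : ℝ} (hbdd : ∀ z ∈ closedStrip, ‖f z‖ ≤ C) :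
    f 0 = ∫ t : ℝ, (weight φ t : ℂ) *
      (Complex.exp (I * (φ / 2)) * f ((1 / 2 : ℂ) + t * I) +
        Complex.exp (-(I * (φ / 2))) * f (-(1 / 2 : ℂ) + t * I)) := by
  have hC : 0 ≤ C := nonneg_of_bound hbdd
  -- the integrand `r` of the right-hand side and its integrability
  set r : ℝ → ℂ := fun t => (weight φ t : ℂ) *
      (Complex.exp (I * (φ / 2)) * f ((1 / 2 : ℂ) + t * I) +
        Complex.exp (-(I * (φ / 2))) * f (-(1 / 2 : ℂ) + t * I)) with hr
  have hfp : Continuous fun t : ℝ => f ((1 / 2 : ℂ) + t * I) := by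
    have := continuous_f_vertical hcont (Or.inl rfl)
    simpa using this
  have hfm : Continuous fun t : ℝ => f (-(1 / 2 : ℂ) + t * I) := by
    have := continuous_f_vertical hcont (Or.inr rfl)
    simpa using this
  have hwc : Continuous (weight φ) := by
    unfold weight
    exact (by fun_prop : Continuous fun t => Real.exp (-(φ * t))).div (by fun_prop) fun t => by positivity
  have hrc : Continuous r := by
    rw [hr]
    exact (Complex.continuous_ofReal.comp hwc).mul
      ((continuous_const.mul hfp).add (continuous_const.mul hfm))
  have hri : Integrable r := by
    refine Integrable.mono' ((integrable_exp_neg_mul_abs (sub_pos.2 hφ)).const_mul (C + C))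
      hrc.aestronglyMeasurable (Eventually.of_forall fun t => ?_)
    rw [hr]
    simp only [norm_mul, Complex.norm_real, Real.norm_eq_abs]
    have hb1 : ‖Complex.exp (I * (φ / 2)) * f ((1 / 2 : ℂ) + t * I)‖ ≤ C := by
      rw [norm_mul, Complex.norm_exp]; simp
      exact hbdd _ (by simp [closedStrip])
    have hb2 : ‖Complex.exp (-(I * (φ / 2))) * f (-(1 / 2 : ℂ) + t * I)‖ ≤ C := by
      rw [norm_mul, Complex.norm_exp]; simp
      exact hbdd _ (by simp [closedStrip])
    calc |weight φ t| * ‖Complex.exp (I * (φ / 2)) * f ((1 / 2 : ℂ) + t * I) +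
          Complex.exp (-(I * (φ / 2))) * f (-(1 / 2 : ℂ) + t * I)‖
        ≤ Real.exp (-(π - |φ|) * |t|) * (C + C) := by
          gcongr
          · exact abs_weight_le φ t
          · exact (norm_add_le _ _).trans (add_le_add hb1 hb2)
      _ = (C + C) * Real.exp (-(π - |φ|) * |t|) := mul_comm _ _
  -- the `f 0` term
  set w0 : ℝ → ℝ := fun t => 1 / (Real.exp (π * t) + Real.exp (-(π * t))) with hw0
  have hw0i : Integrable (fun t => ((w0 t : ℝ) : ℂ)) := integrable_inv_exp_add_exp.ofReal
  have hw0int : ∫ t, ((w0 t : ℝ) : ℂ) = (1 / 2 : ℂ) := by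
    rw [integral_complex_ofReal, hw0]
    simp only
    rw [integral_inv_exp_pi_add_exp_neg_pi]
    norm_num
  -- the difference of the two vertical integrals
  have hdiffint : ∫ t : ℝ, (auxG f φ (((1 / 2 : ℝ) : ℂ) + t * I) -
      auxG f φ (((-(1 / 2) : ℝ) : ℂ) + t * I)) = 0 := by
    rw [MeasureTheory.integral_sub (integrable_auxG_vertical hφ hcont hdiff hbdd (Or.inl rfl))
      (integrable_auxG_vertical hφ hcont hdiff hbdd (Or.inr rfl)),
      integral_auxG_vertical_eq hφ hcont hdiff hbdd, sub_self]
  have hpt : ∀ t : ℝ, auxG f φ (((1 / 2 : ℝ) : ℂ) + t * I) - auxG f φ (((-(1 / 2) : ℝ) : ℂ) + t * I) =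
      (2 * π : ℂ) * r t - (4 * π : ℂ) * (((w0 t : ℝ) : ℂ) * f 0) := by
    intro t
    rw [auxG_half, auxG_neg_half, hr, hw0]
    push_cast
    ring
  have hint2 : ∫ t : ℝ, (auxG f φ (((1 / 2 : ℝ) : ℂ) + t * I) -
      auxG f φ (((-(1 / 2) : ℝ) : ℂ) + t * I)) = (2 * π : ℂ) * (∫ t, r t) - (4 * π : ℂ) * ((1 / 2 : ℂ) * f 0) := by
    simp_rw [hpt]
    rw [MeasureTheory.integral_sub (hri.const_mul _) ((hw0i.mul_const _).const_mul _),
      MeasureTheory.integral_const_mul, MeasureTheory.integral_const_mul,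
      MeasureTheory.integral_mul_const, hw0int]
  rw [hdiffint] at hint2
  -- solve for `∫ r`
  have hπ : (2 * π : ℂ) ≠ 0 := by
    exact mul_ne_zero two_ne_zero (ofReal_ne_zero.2 Real.pi_ne_zero)
  have : (2 * π : ℂ) * ((∫ t, r t) - f 0) = 0 := by
    linear_combination -hint2
  rw [mul_eq_zero] at this
  rcases this with h | h
  · exact absurd h hπ
  · exact (sub_eq_zero.1 h).symm

end Main

end Literature.Analysis.Complex
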